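import Summits.KontsevichZagierPeriods.KontsevichZagierPeriods.Theorems.HurwitzMicroSectorsNormalFormPrincipleM3EbdExistsSimplexReps
import Literature.NumberTheory.Transcendental.KZProductIdeal

/-!
# `NormalFormPrinciple` (stmt-KontsevichZagierPeriods-3869), line `SketchIdeator1` —
# leaf `stub_boxRigidity`, layer `M4` toolkit: the domains of dimension four

Helper file of the lead seat (c9) for the dimension-four campaign of the leaf (`--supports` the
crux): the shared facts about the three domains on which the dimension-four word and product
representations live —

* the decreasing open simplex `Δ₄ = {0 < t₃ < t₂ < t₁ < t₀ < 1}` (it IS `KZ.openOrderedSimplex 4`;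
  `ℚ`-semialgebraic, measurable, coordinates in `(0,1)`),
* the prisms `P₁₃ = (0,1) × Δ₃ = {0 < t₀ < 1, 0 < t₃ < t₂ < t₁ < 1}` and
  `P₂₂ = Δ₂ × Δ₂ = {0 < t₁ < t₀ < 1, 0 < t₃ < t₂ < 1}` (domains of the shuffle products
  `1 ⊗ 3` and `2 ⊗ 2`; `ℚ`-semialgebraic, measurable, coordinates in `(0,1)`),

so that the parallel toolkit files (carriers, charts, Möbius / dilation / reflection moves,
shuffles) import one statement of each instead of re-proving it.
References: M. Kontsevich, D. Zagier, *Periods* (2001), §1.1. No definitions are introduced.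
-/

noncomputable section

open MeasureTheory Set
open Literature.NumberTheory.Transcendental Literature.NumberTheory.Transcendental.KZ
open Literature.ModelTheory.ExponentialFields (IsSemialgebraic)

namespace Summit.KontsevichZagierPeriods.HurwitzMicroSectors.NormalFormPrinciple.PiBox.M3

/-! ## The decreasing open simplex `Δ₄` -/

/-- The decreasing open simplex of `ℝ⁴` written with explicit inequalities is Kontsevich's open
ordered simplex `KZ.openOrderedSimplex 4`. [cite: KontsevichZagier2001, §1.1] -/
theorem m4s_simplex4_eq_openOrderedSimplex :
    {t : Fin 4 → ℝ | 0 < t 3 ∧ t 3 < t 2 ∧ t 2 < t 1 ∧ t 1 < t 0 ∧ t 0 < 1} = openOrderedSimplex 4 := by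
  ext t
  simp only [openOrderedSimplex, mem_setOf_eq]
  constructor
  · rintro ⟨h3, h32, h21, h10, h0⟩
    refine ⟨?_, ?_, ?_⟩
    · intro i
      fin_cases i
      exacts [((h3.trans h32).trans h21).trans h10, (h3.trans h32).trans h21, h3.trans h32, h3]
    · intro i
      fin_cases i
      exacts [h0, h10.trans h0, (h21.trans h10).trans h0, ((h32.trans h21).trans h10).trans h0]
    · rw [Fin.strictAnti_iff_succ_lt]
      intro i
      fin_cases i
      exacts [h10, h21, h32]
  · rintro ⟨hpos, hlt, hanti⟩
    exact ⟨hpos 3, hanti (by decide : (2 : Fin 4) < 3), hanti (by decide : (1 : Fin 4) < 2),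
      hanti (by decide : (0 : Fin 4) < 1), hlt 0⟩

/-- `Δ₄` is `ℚ`-semialgebraic. [cite: KontsevichZagier2001, §1.1] -/
theorem m4s_isSemialgebraic_simplex4 :
    IsSemialgebraic ℚ {t : Fin 4 → ℝ | 0 < t 3 ∧ t 3 < t 2 ∧ t 2 < t 1 ∧ t 1 < t 0 ∧ t 0 < 1} := by
  rw [m4s_simplex4_eq_openOrderedSimplex]
  exact isSemialgebraic_openOrderedSimplex 4

/-- `Δ₄` is Lebesgue measurable. [folklore] -/
theorem m4s_measurableSet_simplex4 :
    MeasurableSet {t : Fin 4 → ℝ | 0 < t 3 ∧ t 3 < t 2 ∧ t 2 < t 1 ∧ t 1 < t 0 ∧ t 0 < 1} := by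
  rw [m4s_simplex4_eq_openOrderedSimplex]
  exact measurableSet_openOrderedSimplex 4

/-- Every coordinate of a point of `Δ₄` lies in `(0,1)`. [folklore] -/
theorem m4s_mem_Ioo_of_mem_simplex4 {t : Fin 4 → ℝ}
    (ht : t ∈ {t : Fin 4 → ℝ | 0 < t 3 ∧ t 3 < t 2 ∧ t 2 < t 1 ∧ t 1 < t 0 ∧ t 0 < 1}) (i : Fin 4) :
    t i ∈ Set.Ioo (0:ℝ) 1 := by
  obtain ⟨h3, h32, h21, h10, h0⟩ := ht
  match i with
  | 0 => exact ⟨by linarith, h0⟩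
  | 1 => exact ⟨by linarith, by linarith⟩
  | 2 => exact ⟨by linarith, by linarith⟩
  | 3 => exact ⟨h3, by linarith⟩

/-! ## The prisms `P₁₃ = (0,1) × Δ₃` and `P₂₂ = Δ₂ × Δ₂` -/

/-- A strict inequality between two coordinates, or between a coordinate and `0` or `1`, cuts out a
`ℚ`-semialgebraic subset of `ℝ⁴`. [cite: KontsevichZagier2001, §1.1] -/
theorem m4s_isSemialgebraic_setOf_lt (p q : MvPolynomial (Fin 4) ℚ) :
    IsSemialgebraic ℚ {t : Fin 4 → ℝ | (MvPolynomial.aeval t p : ℝ) < MvPolynomial.aeval t q} :=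
  Literature.ModelTheory.ExponentialFields.isSemialgebraic_setOf_eval_lt (k := ℚ) (R := ℝ) p q

/-- `P₁₃ = (0,1) × Δ₃` is `ℚ`-semialgebraic: six strict `ℚ`-polynomial inequalities.
[cite: KontsevichZagier2001, §1.1] -/
theorem m4s_isSemialgebraic_prism13 :
    IsSemialgebraic ℚ {t : Fin 4 → ℝ | 0 < t 0 ∧ t 0 < 1 ∧ 0 < t 3 ∧ t 3 < t 2 ∧ t 2 < t 1 ∧ t 1 < 1} := by
  have h1 := m4s_isSemialgebraic_setOf_lt 0 (MvPolynomial.X 0)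
  have h2 := m4s_isSemialgebraic_setOf_lt (MvPolynomial.X 0) 1
  have h3 := m4s_isSemialgebraic_setOf_lt 0 (MvPolynomial.X 3)
  have h4 := m4s_isSemialgebraic_setOf_lt (MvPolynomial.X 3) (MvPolynomial.X 2)
  have h5 := m4s_isSemialgebraic_setOf_lt (MvPolynomial.X 2) (MvPolynomial.X 1)
  have h6 := m4s_isSemialgebraic_setOf_lt (MvPolynomial.X 1) 1
  simp only [MvPolynomial.aeval_X, map_zero, map_one] at h1 h2 h3 h4 h5 h6
  have hP : {t : Fin 4 → ℝ | 0 < t 0 ∧ t 0 < 1 ∧ 0 < t 3 ∧ t 3 < t 2 ∧ t 2 < t 1 ∧ t 1 < 1} =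
      {t : Fin 4 → ℝ | 0 < t 0} ∩ {t | t 0 < 1} ∩ {t | 0 < t 3} ∩ {t | t 3 < t 2} ∩
        {t | t 2 < t 1} ∩ {t | t 1 < 1} := by
    ext t
    simp only [mem_setOf_eq, mem_inter_iff, and_assoc]
  rw [hP]
  exact ((((h1.inter h2).inter h3).inter h4).inter h5).inter h6

/-- `P₂₂ = Δ₂ × Δ₂` is `ℚ`-semialgebraic: six strict `ℚ`-polynomial inequalities.
[cite: KontsevichZagier2001, §1.1] -/
theorem m4s_isSemialgebraic_prism22 :
    IsSemialgebraic ℚ {t : Fin 4 → ℝ | 0 < t 1 ∧ t 1 < t 0 ∧ t 0 < 1 ∧ 0 < t 3 ∧ t 3 < t 2 ∧ t 2 < 1} := by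
  have h1 := m4s_isSemialgebraic_setOf_lt 0 (MvPolynomial.X 1)
  have h2 := m4s_isSemialgebraic_setOf_lt (MvPolynomial.X 1) (MvPolynomial.X 0)
  have h3 := m4s_isSemialgebraic_setOf_lt (MvPolynomial.X 0) 1
  have h4 := m4s_isSemialgebraic_setOf_lt 0 (MvPolynomial.X 3)
  have h5 := m4s_isSemialgebraic_setOf_lt (MvPolynomial.X 3) (MvPolynomial.X 2)
  have h6 := m4s_isSemialgebraic_setOf_lt (MvPolynomial.X 2) 1
  simp only [MvPolynomial.aeval_X, map_zero, map_one] at h1 h2 h3 h4 h5 h6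
  have hP : {t : Fin 4 → ℝ | 0 < t 1 ∧ t 1 < t 0 ∧ t 0 < 1 ∧ 0 < t 3 ∧ t 3 < t 2 ∧ t 2 < 1} =
      {t : Fin 4 → ℝ | 0 < t 1} ∩ {t | t 1 < t 0} ∩ {t | t 0 < 1} ∩ {t | 0 < t 3} ∩
        {t | t 3 < t 2} ∩ {t | t 2 < 1} := by
    ext t
    simp only [mem_setOf_eq, mem_inter_iff, and_assoc]
  rw [hP]
  exact ((((h1.inter h2).inter h3).inter h4).inter h5).inter h6

/-- `P₁₃` is Lebesgue measurable. [folklore] -/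
theorem m4s_measurableSet_prism13 :
    MeasurableSet {t : Fin 4 → ℝ | 0 < t 0 ∧ t 0 < 1 ∧ 0 < t 3 ∧ t 3 < t 2 ∧ t 2 < t 1 ∧ t 1 < 1} :=
  m4s_isSemialgebraic_prism13.measurableSet_holds

/-- `P₂₂` is Lebesgue measurable. [folklore] -/
theorem m4s_measurableSet_prism22 :
    MeasurableSet {t : Fin 4 → ℝ | 0 < t 1 ∧ t 1 < t 0 ∧ t 0 < 1 ∧ 0 < t 3 ∧ t 3 < t 2 ∧ t 2 < 1} :=
  m4s_isSemialgebraic_prism22.measurableSet_holds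

/-- Every coordinate of a point of `P₁₃` lies in `(0,1)`. [folklore] -/
theorem m4s_mem_Ioo_of_mem_prism13 {t : Fin 4 → ℝ}
    (ht : t ∈ {t : Fin 4 → ℝ | 0 < t 0 ∧ t 0 < 1 ∧ 0 < t 3 ∧ t 3 < t 2 ∧ t 2 < t 1 ∧ t 1 < 1})
    (i : Fin 4) : t i ∈ Set.Ioo (0:ℝ) 1 := by
  obtain ⟨h0, h01, h3, h32, h21, h1⟩ := ht
  match i with
  | 0 => exact ⟨h0, h01⟩
  | 1 => exact ⟨by linarith, h1⟩
  | 2 => exact ⟨by linarith, by linarith⟩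
  | 3 => exact ⟨h3, by linarith⟩

/-- Every coordinate of a point of `P₂₂` lies in `(0,1)`. [folklore] -/
theorem m4s_mem_Ioo_of_mem_prism22 {t : Fin 4 → ℝ}
    (ht : t ∈ {t : Fin 4 → ℝ | 0 < t 1 ∧ t 1 < t 0 ∧ t 0 < 1 ∧ 0 < t 3 ∧ t 3 < t 2 ∧ t 2 < 1})
    (i : Fin 4) : t i ∈ Set.Ioo (0:ℝ) 1 := by
  obtain ⟨h1, h10, h0, h3, h32, h2⟩ := ht
  match i with
  | 0 => exact ⟨by linarith, h0⟩
  | 1 => exact ⟨h1, by linarith⟩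
  | 2 => exact ⟨by linarith, h2⟩
  | 3 => exact ⟨h3, by linarith⟩

/-- **The word representation on `Δ₄` with integrand dominated by an absolutely integrable
function exists.** If `F` is `ℚ`-semialgebraic on `Δ₄`, continuous there, and `|F| ≤ G` on `Δ₄` for
some `G` integrable on `Δ₄`, then `[Δ₄, F]` is an integral representation. (Packaging of the
structure fields; the domination is `MeasureTheory.Integrable.mono'`.) [cite: KontsevichZagier2001, §1.1] -/
theorem m4s_exists_rep_of_abs_le {F G : (Fin 4 → ℝ) → ℝ}
    (hF : IsSemialgebraicFunOn ℚ {t : Fin 4 → ℝ | 0 < t 3 ∧ t 3 < t 2 ∧ t 2 < t 1 ∧ t 1 < t 0 ∧ t 0 < 1} F)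
    (hFc : ContinuousOn F {t : Fin 4 → ℝ | 0 < t 3 ∧ t 3 < t 2 ∧ t 2 < t 1 ∧ t 1 < t 0 ∧ t 0 < 1})
    (hG : IntegrableOn G {t : Fin 4 → ℝ | 0 < t 3 ∧ t 3 < t 2 ∧ t 2 < t 1 ∧ t 1 < t 0 ∧ t 0 < 1})
    (hle : ∀ t ∈ {t : Fin 4 → ℝ | 0 < t 3 ∧ t 3 < t 2 ∧ t 2 < t 1 ∧ t 1 < t 0 ∧ t 0 < 1}, |F t| ≤ G t) :
    ∃ T : IntegralRep 4, T.domain = {t | 0 < t 3 ∧ t 3 < t 2 ∧ t 2 < t 1 ∧ t 1 < t 0 ∧ t 0 < 1} ∧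
      T.integrand = F := by
  refine ⟨⟨_, F, m4s_isSemialgebraic_simplex4, hF, ?_⟩, rfl, rfl⟩
  refine Integrable.mono' hG (hFc.aestronglyMeasurable m4s_measurableSet_simplex4) ?_
  exact (ae_restrict_iff' m4s_measurableSet_simplex4).2 (Filter.Eventually.of_forall
    fun t ht => (Real.norm_eq_abs _).le.trans (hle t ht))

end Summit.KontsevichZagierPeriods.HurwitzMicroSectors.NormalFormPrinciple.PiBox.M3
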